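/-
Copyright (c) 2026 the pub-hodgecm-mathlib formalisation cell (harness21).  Prover seat hodgecm-mathlib-F0P3a-p04 (g16), 2026-09-01.  Road «S3-tree» (architect A-p16 (g29)),
brick T3′ «depth-zero κ-transfer» (holder F0P3b-p01 (g11)), population (P-3) LEVI: organ L-α1 «RANK STRATA OF A RESIDUALLY UNITRIANGULAR `3×3` MATRIX» (census
`F0/P3a/F0P3a-p04/g16/CENSUS-T3prime-P3.F0P3a-p04g16.md` §1 L-α, algebraic half).
-/
import Literature.NumberTheory.Automorphic.ResiduallyUnipotentCyclicLattices     -- ★ A-p12: `rank_eq_sub_one_iff_natDegree_minpoly_eq_of_isNilpotent`, `exists_linearIndependent_pow_mulVec_iff_natDegree_minpoly_eq`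
import Literature.NumberTheory.Automorphic.UnitaryDepthZeroPieceOrbitalIntegral   -- ★ A-p12: `rank_lt_of_isNilpotent`
import Literature.NumberTheory.Automorphic.IntegralMatrixReduction                -- ★ `IntegralReduction.red ∕ redMat` (reduction mod `𝔪`)
import HarnessLib

/-!
# The Jordan rank of a unitriangular `3×3` matrix modulo `𝔪`: `rank(red [[1,a,b],[0,1,c],[0,0,1]] − 1) ∈ {0,1,2}` read off the residues of `a, b, c`

Topic `NumberTheory/Automorphic`; namespace `Literature.NumberTheory.Automorphic`.  THEOREMS ONLY (no definition, no instance, no notation, no named fact, no `sorry`); §1 over any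
field `𝕜`, §2 over any valued field `[Field K] [ValuativeRel K]` in ★ `IntegralReduction` currency.  Cell `pub/hodgecm-mathlib`, crux H413 = `stmt-HodgeConjecture-24833`; road
«S3-tree», brick T3′ (HEAD v4 clause `depthZeroKappaTransfer_hyperspecial_levi`, DESIGN v2 §2 (P-3); census «T3′ P-3» §0 (iv), §1 L-α).  HONEST LABEL: HC_CM is proved only modulo the
cell's 2 remaining named inputs (hLiu418 24832, h413 24833) until rung 0 closes; this file is elementary linear algebra and asserts nothing printed.

THE MATHEMATICS.  The depth-zero piece of T3′ reads a hyperspecial element `k` through the JORDAN RANK `rank(red(k_w) − 1)` of its reduction.  On the LEVI population the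
relevant elements are `t·n` with `t ≡ 1 mod 𝔪` in the diagonal torus and `n` in the unipotent radical `N` (Heisenberg group, ★ `HeisRing.heisMatrix x y = [[1, x, z], [0, 1, −σx],
[0, 0, 1]]`, `z = y − ½xσx`), so `red(tn) − 1 = red(n) − 1 = [[0, ā, b̄], [0, 0, c̄], [0, 0, 0]]` with `(a, b, c) = (x, z, −σx)`.  For the strictly upper triangular
`S(ā, b̄, c̄) := [[0, ā, b̄], [0, 0, c̄], [0, 0, 0]]` over a field: `S³ = 0`, `S² = āc̄·E₀₂`;
* `ā ≠ 0`, `c̄ ≠ 0` ⇒ `rank S = 2` (the Krylov vectors `e₂, Se₂ = (b̄, c̄, 0), S²e₂ = (āc̄, 0, 0)` are independent — determinant `−āc̄²` — so `deg q_S = 3` and ★ A-p12's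
  «rank `n−1` ⟺ cyclic» gives rank `2`);
* `ā = c̄ = 0`, `b̄ ≠ 0` ⇒ `rank S = 1` (`S ≠ 0`, `S² = 0`: a Krylov triple would contain `S²v = 0`, so `rank ≠ 2`; nilpotent ⇒ `rank < 3`; `S ≠ 0` ⇒ `rank ≠ 0`);
* `ā = b̄ = c̄ = 0` ⇒ `rank S = 0`.
In the Heisenberg case `c = −σx` has the residue class of `x` up to the residual involution (so `c̄ ≠ 0 ⟺ ā ≠ 0`) and `b̄ = ȳ` when `ā = 0` — hence the three strata are
«`|x| = 1`», «`|x| < 1 = |y|`», «`|x|, |y| < 1`» (the measure half is the sequel file; counts `(q³ − q, q − 1, 1)` in `N(𝔽_q)`).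

* §1 (field `𝕜`) `strictUpper_sq`, `strictUpper_pow_three`, `isNilpotent_strictUpper`, `rank_eq_zero_of_eq_zero'`/`eq_zero_of_rank_eq_zero`, **`rank_strictUpper_eq_two`**,
  **`rank_strictUpper_eq_one`**, **`rank_strictUpper_eq_zero`**.
* §2 (valued field `K`) **`redMat_unitriangular_sub_one`** (`red [[1,a,b],[0,1,c],[0,0,1]] − 1 = S(ā, b̄, c̄)` for integral `a b c`), the three rank corollaries
  `rank_redMat_unitriangular_sub_one_eq_two ∕ _one ∕ _zero` in terms of `valuation a = 1` etc., and **`redMat_mul_of_redMat_eq_one`** (`red(tn) = red n` when `red t = 1`).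

## References
* [HornJohnson2013] R. A. Horn, C. R. Johnson, *Matrix Analysis*, 2nd ed. (2013), §3.2 Problem 3.2.P27 (rank and index of a nilpotent matrix), Thm. 3.3.15.
* [Rogawski1990] J. D. Rogawski, *Automorphic Representations of Unitary Groups in Three Variables* (1990), §1.10 p. 9 (`N = {u(x, z)}`), §4.9 p. 54.
* [IwahoriMatsumoto1965] N. Iwahori, H. Matsumoto, *On some Bruhat decomposition…*, Publ. IHÉS 25 (1965), §2 (reduction mod `𝔓`).
-/

set_option autoImplicit false

open Matrix Polynomial ValuativeRel
open scoped ValuativeRel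

namespace Literature.NumberTheory.Automorphic

/-! ## §1 The strictly upper triangular `3×3` matrix `S(a, b, c)` over a field -/

section Field

variable {𝕜 : Type*} [Field 𝕜]

/-- `S(a,b,c)² = ac · E₀₂`. [cite: HornJohnson2013, §3.2 Problem 3.2.P27] -/
theorem strictUpper_sq (a b c : 𝕜) : !![0, a, b; 0, 0, c; 0, 0, (0 : 𝕜)] ^ 2 = !![0, 0, a * c; 0, 0, 0; 0, 0, 0] := by
  ext i j
  fin_cases i <;> fin_cases j <;> simp [pow_two, Matrix.mul_apply, Fin.sum_univ_three]

/-- `S(a,b,c)³ = 0`. [cite: HornJohnson2013, §3.2 Problem 3.2.P27] -/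
theorem strictUpper_pow_three (a b c : 𝕜) : !![0, a, b; 0, 0, c; 0, 0, (0 : 𝕜)] ^ 3 = 0 := by
  rw [pow_succ, strictUpper_sq]
  ext i j
  fin_cases i <;> fin_cases j <;> simp [Matrix.mul_apply, Fin.sum_univ_three]

/-- `S(a,b,c)` is nilpotent. [cite: HornJohnson2013, §3.2 Problem 3.2.P27] -/
theorem isNilpotent_strictUpper (a b c : 𝕜) : IsNilpotent !![0, a, b; 0, 0, c; 0, 0, (0 : 𝕜)] :=
  ⟨3, strictUpper_pow_three a b c⟩

/-- A matrix over a field of rank `0` is `0`. [cite: HornJohnson2013, §0.4] -/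
theorem eq_zero_of_rank_eq_zero {m n : Type*} [Fintype m] [Fintype n] [DecidableEq n] {M : Matrix m n 𝕜} (h : M.rank = 0) : M = 0 := by
  rw [Matrix.rank_eq_finrank_span_cols, Submodule.finrank_eq_zero] at h
  ext i j
  have hj : M.col j ∈ Submodule.span 𝕜 (Set.range M.col) := Submodule.subset_span ⟨j, rfl⟩
  rw [h, Submodule.mem_bot] at hj
  exact congrFun hj i

/-- **`rank S(a,b,c) = 2` when `a ≠ 0` and `c ≠ 0`**: the Krylov vectors `e₂, Se₂, S²e₂` are independent (determinant `−ac²`), so `deg q_S = 3` and a nilpotent `3×3` matrix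
with `deg q = 3` has rank `2` (★ A-p12). [cite: HornJohnson2013, §3.2 Problem 3.2.P27 (b); Thm. 3.3.15] -/
theorem rank_strictUpper_eq_two {a c : 𝕜} (ha : a ≠ 0) (hc : c ≠ 0) (b : 𝕜) : (!![0, a, b; 0, 0, c; 0, 0, (0 : 𝕜)]).rank = 2 := by
  have hnil := isNilpotent_strictUpper a b c
  suffices hdeg : (minpoly 𝕜 !![0, a, b; 0, 0, c; 0, 0, (0 : 𝕜)]).natDegree = 3 by
    have h := (rank_eq_sub_one_iff_natDegree_minpoly_eq_of_isNilpotent hnil).2 hdeg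
    simpa using h
  rw [← exists_linearIndependent_pow_mulVec_iff_natDegree_minpoly_eq]
  refine ⟨Pi.single 2 1, ?_⟩
  -- the Krylov matrix with ROWS `S^j e₂`
  have hrows : (fun j : Fin 3 => !![0, a, b; 0, 0, c; 0, 0, (0 : 𝕜)] ^ (j : ℕ) *ᵥ Pi.single 2 1) =
      (!![0, 0, 1; b, c, 0; a * c, 0, (0 : 𝕜)]).row := by
    funext j
    fin_cases j
    · ext i; fin_cases i <;> simp
    · ext i; fin_cases i <;> simp [Matrix.mulVec, dotProduct, Fin.sum_univ_three]
    · simp only [Fin.reduceFinMk, strictUpper_sq]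
      ext i; fin_cases i <;> simp [Matrix.mulVec, dotProduct, Fin.sum_univ_three]
  rw [hrows, Matrix.linearIndependent_rows_iff_isUnit, Matrix.isUnit_iff_isUnit_det]
  have hdet : (!![0, 0, 1; b, c, 0; a * c, 0, (0 : 𝕜)]).det = -(a * c ^ 2) := by
    simp [Matrix.det_fin_three]; ring
  rw [hdet, isUnit_iff_ne_zero]
  exact neg_ne_zero.2 (mul_ne_zero ha (pow_ne_zero 2 hc))

/-- **`rank S(0,b,0) = 1` when `b ≠ 0`**: `S ≠ 0` (so rank `≠ 0`), `S² = 0` (so no Krylov triple is independent and rank `≠ 2`), nilpotent (rank `< 3`).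
[cite: HornJohnson2013, §3.2 Problem 3.2.P27 (b)] -/
theorem rank_strictUpper_eq_one {b : 𝕜} (hb : b ≠ 0) : (!![0, 0, b; 0, 0, 0; 0, 0, (0 : 𝕜)]).rank = 1 := by
  have hnil := isNilpotent_strictUpper (0 : 𝕜) b 0
  have hlt : (!![0, 0, b; 0, 0, 0; 0, 0, (0 : 𝕜)]).rank < 3 := rank_lt_of_isNilpotent hnil (by norm_num)
  have hne0 : (!![0, 0, b; 0, 0, 0; 0, 0, (0 : 𝕜)]).rank ≠ 0 := fun h0 => by
    have h := congrFun (congrFun (eq_zero_of_rank_eq_zero h0) 0) 2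
    simp at h
    exact hb h
  have hne2 : (!![0, 0, b; 0, 0, 0; 0, 0, (0 : 𝕜)]).rank ≠ 2 := by
    intro h2
    have h2' : (!![0, 0, b; 0, 0, 0; 0, 0, (0 : 𝕜)]).rank = 3 - 1 := h2.trans (by norm_num)
    rw [rank_eq_sub_one_iff_natDegree_minpoly_eq_of_isNilpotent hnil,
      ← exists_linearIndependent_pow_mulVec_iff_natDegree_minpoly_eq] at h2'
    obtain ⟨v, hv⟩ := h2'
    have hsq : !![0, 0, b; 0, 0, 0; 0, 0, (0 : 𝕜)] ^ 2 = 0 := by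
      rw [strictUpper_sq, zero_mul]
      ext i j; fin_cases i <;> fin_cases j <;> simp
    have h0 : !![0, 0, b; 0, 0, 0; 0, 0, (0 : 𝕜)] ^ ((2 : Fin 3) : ℕ) *ᵥ v = 0 := by
      rw [show ((2 : Fin 3) : ℕ) = 2 from rfl, hsq, Matrix.zero_mulVec]
    exact hv.ne_zero 2 h0
  omega

/-- **`rank S(0,0,0) = 0`.** [cite: HornJohnson2013, §0.4] -/
theorem rank_strictUpper_eq_zero : (!![0, 0, 0; 0, 0, 0; 0, 0, (0 : 𝕜)]).rank = 0 := by
  have h : (!![0, 0, 0; 0, 0, 0; 0, 0, (0 : 𝕜)]) = 0 := by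
    ext i j; fin_cases i <;> fin_cases j <;> rfl
  rw [h, Matrix.rank_zero]

end Field

/-! ## §2 The residual reading: `red [[1,a,b],[0,1,c],[0,0,1]] − 1 = S(ā, b̄, c̄)` and the three strata by valuations -/

section Valued

variable {K : Type*} [Field K] [ValuativeRel K]

open IntegralReduction

/-- **`redMat [[1,a,b],[0,1,c],[0,0,1]] − 1 = S(ā, b̄, c̄)`** for integral `a b c` (`red 1 = 1`, `red 0 = 0`). [cite: IwahoriMatsumoto1965, §2] -/
theorem redMat_unitriangular_sub_one (a b c : K) :
    redMat !![1, a, b; 0, 1, c; 0, 0, (1 : K)] - 1 = !![0, red a, red b; 0, 0, red c; 0, 0, (0 : 𝓀[K])] := by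
  have h0 : red (0 : K) = 0 := by rw [show (0 : K) = ((0 : 𝒪[K]) : K) from rfl, red_coe, map_zero]
  ext i j
  fin_cases i <;> fin_cases j <;> simp [redMat, Matrix.map_apply, red_one, h0]

/-- **RANK 2 STRATUM**: `|a| = 1` and `|c| = 1` (`b` integral) ⇒ `rank(red [[1,a,b],[0,1,c],[0,0,1]] − 1) = 2`. [cite: HornJohnson2013, §3.2 Problem 3.2.P27 (b)] -/
theorem rank_redMat_unitriangular_sub_one_eq_two {a b c : K} (ha : valuation K a = 1) (hc : valuation K c = 1) :
    (redMat !![1, a, b; 0, 1, c; 0, 0, (1 : K)] - 1).rank = 2 := by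
  rw [redMat_unitriangular_sub_one]
  exact rank_strictUpper_eq_two (red_ne_zero_of_valuation_eq_one ha) (red_ne_zero_of_valuation_eq_one hc) _

/-- **RANK 1 STRATUM**: `|a| < 1`, `|c| < 1`, `|b| = 1` ⇒ `rank(red [[1,a,b],[0,1,c],[0,0,1]] − 1) = 1`. [cite: HornJohnson2013, §3.2 Problem 3.2.P27 (b)] -/
theorem rank_redMat_unitriangular_sub_one_eq_one {a b c : K} (ha : valuation K a < 1) (hb : valuation K b = 1) (hc : valuation K c < 1) :
    (redMat !![1, a, b; 0, 1, c; 0, 0, (1 : K)] - 1).rank = 1 := by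
  have hra : red a = 0 := by
    by_contra h
    exact absurd (valuation_eq_one_of_red_ne_zero ((Valuation.mem_integer_iff _ _).2 ha.le) h) (ne_of_lt ha)
  have hrc : red c = 0 := by
    by_contra h
    exact absurd (valuation_eq_one_of_red_ne_zero ((Valuation.mem_integer_iff _ _).2 hc.le) h) (ne_of_lt hc)
  rw [redMat_unitriangular_sub_one, hra, hrc]
  exact rank_strictUpper_eq_one (red_ne_zero_of_valuation_eq_one hb)

/-- **RANK 0 STRATUM**: `|a|, |b|, |c| < 1` ⇒ `rank(red [[1,a,b],[0,1,c],[0,0,1]] − 1) = 0`. [cite: HornJohnson2013, §0.4] -/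
theorem rank_redMat_unitriangular_sub_one_eq_zero {a b c : K} (ha : valuation K a < 1) (hb : valuation K b < 1) (hc : valuation K c < 1) :
    (redMat !![1, a, b; 0, 1, c; 0, 0, (1 : K)] - 1).rank = 0 := by
  have hr : ∀ {x : K}, valuation K x < 1 → red x = 0 := fun {x} hx => by
    by_contra h
    exact absurd (valuation_eq_one_of_red_ne_zero ((Valuation.mem_integer_iff _ _).2 hx.le) h) (ne_of_lt hx)
  rw [redMat_unitriangular_sub_one, hr ha, hr hb, hr hc]
  exact rank_strictUpper_eq_zero

/-- **DEEP TORUS ELEMENTS DO NOT CHANGE THE STRATUM**: if `red t = 1` (`t` integral with `t ≡ 1 mod 𝔪`) and `n` is integral then `red(t·n) = red n`, so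
`rank(red(tn) − 1) = rank(red n − 1)`. [cite: IwahoriMatsumoto1965, §2] [cite: Rogawski1990, §4.9 p. 54] -/
theorem redMat_mul_of_redMat_eq_one {m : Type*} [Fintype m] [DecidableEq m] {t n : Matrix m m K} (ht : ValBound 1 t) (hn : ValBound 1 n)
    (ht1 : redMat t = 1) : redMat (t * n) = redMat n := by
  rw [redMat_mul ht hn, ht1, one_mul]

end Valued

end Literature.NumberTheory.Automorphic
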